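import Literature.Analysis.ValidatedNumerics.ExpPoly.Correlation
import HarnessLib

/-!
# Divided differences of a polynomial as exact bivariate coefficient lists

Trunk T-ANA (Analysis/ValidatedNumerics); namespace `Literature.Analysis.ValidatedNumerics.ExpPoly`.
Sequel of `ExpPoly/Correlation.lean` (`BPoly`: outer index = power of `x`, entries = polynomials in `t`).  For a rational
polynomial `g` and a rational centre `y₀`, the DIVIDED second and first differences

  `E(ρ, t) = (2 g(y₀+ρ) − g(y₀+ρ−t) − g(y₀+ρ+t)) / t`,   `H(ρ, t) = (g(y₀+ρ) − g(y₀+ρ−t)) / t`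

are polynomials in `(ρ, t)`; this file computes them EXACTLY over `ℚ` as `BPoly`s in the outer variable `ρ` with inner
polynomials in `t` (`secondDiffQuot g y₀`, `firstDiffQuot g y₀`), with a kernel-decidable consistency check
(`secondDiffCheck`, `firstDiffCheck`: the constant-in-`t` terms of the numerators vanish) and the soundness identities
`t · E(ρ,t) = 2g(y₀+ρ) − g(y₀+ρ−t) − g(y₀+ρ+t)` (`eval_secondDiffQuot`) and `t · H(ρ,t) = g(y₀+ρ) − g(y₀+ρ−t)`
(`eval_firstDiffQuot`).  These are the integrands of the archimedean layer of the window image of a windowed polynomial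
trial vector (`∫_0^{c−y} G(t) E(y,t) dt + ∫_{c−y}^{c+y} G(t) H(y,t) dt`, deflated Temple L-sides of the Weil form), fed to
`TaylorModelMovingIntegral.movingIntegBTM` panel by panel (`y = y₀ + ρ`).  Tools: `Poly.taylorShift p c = p(c + ·)`,
`BPoly.mapInner`, `BPoly.eval_map_of`.  No facts, no axioms.

## References

* Divided differences of polynomials are polynomials (any algebra text); Horner / Taylor shift. [folklore]
-/

namespace Literature.Analysis.ValidatedNumerics.ExpPoly

/-! ## Univariate helpers -/

namespace Poly

/-- `p(c + u)` as an exact polynomial in `u`. [folklore] -/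
def taylorShift (p : Poly) (c : ℚ) : Poly := BPoly.subst (BPoly.taylor p) [c]

/-- [folklore] -/
theorem eval_taylorShift (p : Poly) (c : ℚ) (u : ℝ) : eval (taylorShift p c) u = eval p ((c : ℝ) + u) := by
  rw [taylorShift, BPoly.eval_subst, BPoly.eval_taylor]
  simp [eval, add_comm]

/-- `Poly.shift p c₀` evaluates to `p(c₀ − s)`. [folklore] -/
theorem eval_shift (c0 : ℚ) (s : ℝ) : ∀ p : Poly, eval (shift p c0) s = eval p ((c0 : ℝ) - s)
  | [] => by simp [eval_shift_nil, eval]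
  | c :: cs => by rw [eval_shift_cons, eval_shift c0 s cs, eval]

/-- If the constant coefficient vanishes, `t · (tail p)(t) = p(t)`. [folklore] -/
theorem mul_eval_tail_of_headD {p : Poly} (hp : p.headD 0 = 0) (t : ℝ) : t * eval p.tail t = eval p t := by
  cases p with
  | nil => simp [eval]
  | cons c cs =>
      simp only [List.headD_cons] at hp
      simp [eval, hp]

end Poly

/-! ## Bivariate helpers -/

namespace BPoly

/-- Apply a map to every inner polynomial. [folklore] -/
def mapInner (f : Poly → Poly) (P : BPoly) : BPoly := P.map f

/-- If `f` acts on inner polynomials as the substitution `t ↦ t'`, then so does `mapInner f`. [folklore] -/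
theorem eval_map_of {f : Poly → Poly} {t t' : ℝ} (hf : ∀ Q : Poly, Poly.eval (f Q) t = Poly.eval Q t') :
    ∀ (P : BPoly) (x : ℝ), eval (mapInner f P) t x = eval P t' x
  | [], x => by simp [mapInner]
  | c :: P, x => by
      have ih := eval_map_of hf P x
      simp only [mapInner, List.map_cons, eval_cons] at ih ⊢
      rw [hf, ih]

/-- Negation of a bivariate list. [folklore] -/
def neg (P : BPoly) : BPoly := mapInner (Poly.smul (-1)) P

/-- [folklore] -/
theorem eval_neg (P : BPoly) (t x : ℝ) : eval (neg P) t x = -eval P t x := by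
  induction P with
  | nil => simp [neg, mapInner]
  | cons c P ih =>
      simp only [neg, mapInner, List.map_cons, eval_cons] at ih ⊢
      rw [Poly.eval_smul, ih]
      push_cast
      ring

/-- Scalar multiple of a bivariate list. [folklore] -/
def smul (a : ℚ) (P : BPoly) : BPoly := mapInner (Poly.smul a) P

/-- [folklore] -/
theorem eval_smul (a : ℚ) (P : BPoly) (t x : ℝ) : eval (smul a P) t x = (a : ℝ) * eval P t x := by
  induction P with
  | nil => simp [smul, mapInner]
  | cons c P ih =>
      simp only [smul, mapInner, List.map_cons, eval_cons] at ih ⊢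
      rw [Poly.eval_smul, ih]
      ring

/-- The check "every inner polynomial has constant coefficient `0`". [folklore] -/
def headsZero (P : BPoly) : Bool := P.all fun Q => decide (Q.headD 0 = 0)

/-- If every inner constant coefficient vanishes, `t · (inner tails)(t, x) = P(t, x)`. [folklore] -/
theorem mul_eval_tails_of_headsZero : ∀ {P : BPoly}, headsZero P = true → ∀ (t x : ℝ),
    t * eval (mapInner List.tail P) t x = eval P t x
  | [], _, t, x => by simp [mapInner]
  | c :: P, h, t, x => by
      simp only [headsZero, List.all_cons, Bool.and_eq_true, decide_eq_true_eq] at h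
      have ih := mul_eval_tails_of_headsZero (P := P) (by simpa [headsZero] using h.2) t x
      simp only [mapInner, List.map_cons, eval_cons] at ih ⊢
      rw [← Poly.mul_eval_tail_of_headD h.1 t, ← ih]
      ring

end BPoly

/-! ## The shifted copies of `g` around `y₀` -/

/-- `g(y₀ + ρ + t)` as a `BPoly` (outer `ρ`, inner `t`). [folklore] -/
def shiftPlus (g : Poly) (y0 : ℚ) : BPoly := BPoly.taylor (Poly.taylorShift g y0)

/-- [folklore] -/
theorem eval_shiftPlus (g : Poly) (y0 : ℚ) (t ρ : ℝ) :
    BPoly.eval (shiftPlus g y0) t ρ = Poly.eval g ((y0 : ℝ) + ρ + t) := by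
  rw [shiftPlus, BPoly.eval_taylor, Poly.eval_taylorShift]
  ring_nf

/-- `g(y₀ + ρ − t)` as a `BPoly`: the inner polynomials of `shiftPlus` composed with `t ↦ −t`. [folklore] -/
def shiftMinus (g : Poly) (y0 : ℚ) : BPoly := BPoly.mapInner (fun Q => Poly.shift Q 0) (shiftPlus g y0)

/-- [folklore] -/
theorem eval_shiftMinus (g : Poly) (y0 : ℚ) (t ρ : ℝ) :
    BPoly.eval (shiftMinus g y0) t ρ = Poly.eval g ((y0 : ℝ) + ρ - t) := by
  rw [shiftMinus, BPoly.eval_map_of (t' := -t) (fun Q => by rw [Poly.eval_shift]; simp), eval_shiftPlus]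
  ring_nf

/-- `g(y₀ + ρ)` as a `BPoly` with constant inner polynomials. [folklore] -/
def shiftZero (g : Poly) (y0 : ℚ) : BPoly := BPoly.mapInner (fun Q => [Q.headD 0]) (shiftPlus g y0)

/-- [folklore] -/
theorem eval_shiftZero (g : Poly) (y0 : ℚ) (t ρ : ℝ) :
    BPoly.eval (shiftZero g y0) t ρ = Poly.eval g ((y0 : ℝ) + ρ) := by
  rw [shiftZero, BPoly.eval_map_of (t' := 0) (fun Q => by simp [Poly.eval, Poly.eval_zero_eq_headD]),
    eval_shiftPlus, add_zero]

/-! ## The divided second difference `E` -/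

/-- Numerator `2g(y₀+ρ) − g(y₀+ρ−t) − g(y₀+ρ+t)` as a `BPoly`. [folklore] -/
def secondDiffNum (g : Poly) (y0 : ℚ) : BPoly :=
  BPoly.add (BPoly.smul 2 (shiftZero g y0)) (BPoly.neg (BPoly.add (shiftMinus g y0) (shiftPlus g y0)))

/-- [folklore] -/
theorem eval_secondDiffNum (g : Poly) (y0 : ℚ) (t ρ : ℝ) :
    BPoly.eval (secondDiffNum g y0) t ρ =
      2 * Poly.eval g ((y0 : ℝ) + ρ) - Poly.eval g ((y0 : ℝ) + ρ - t) - Poly.eval g ((y0 : ℝ) + ρ + t) := by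
  rw [secondDiffNum, BPoly.eval_add, BPoly.eval_smul, BPoly.eval_neg, BPoly.eval_add, eval_shiftZero,
    eval_shiftMinus, eval_shiftPlus]
  push_cast
  ring

/-- Kernel check: the numerator is divisible by `t` coefficientwise (always true; decided per instance). [folklore] -/
def secondDiffCheck (g : Poly) (y0 : ℚ) : Bool := BPoly.headsZero (secondDiffNum g y0)

/-- **The divided second difference** `E(ρ,t) = (2g(y₀+ρ) − g(y₀+ρ−t) − g(y₀+ρ+t))/t` as a `BPoly`. [folklore] -/
def secondDiffQuot (g : Poly) (y0 : ℚ) : BPoly := BPoly.mapInner List.tail (secondDiffNum g y0)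

/-- Soundness: `t · E(ρ,t) = 2g(y₀+ρ) − g(y₀+ρ−t) − g(y₀+ρ+t)` (given the check). [folklore] -/
theorem eval_secondDiffQuot {g : Poly} {y0 : ℚ} (hc : secondDiffCheck g y0 = true) (t ρ : ℝ) :
    t * BPoly.eval (secondDiffQuot g y0) t ρ =
      2 * Poly.eval g ((y0 : ℝ) + ρ) - Poly.eval g ((y0 : ℝ) + ρ - t) - Poly.eval g ((y0 : ℝ) + ρ + t) := by
  rw [secondDiffQuot, BPoly.mul_eval_tails_of_headsZero hc, eval_secondDiffNum]

/-- The divided form: for `t ≠ 0`, `E(ρ,t) = (2g(y₀+ρ) − g(y₀+ρ−t) − g(y₀+ρ+t))/t`. [folklore] -/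
theorem eval_secondDiffQuot_eq_div {g : Poly} {y0 : ℚ} (hc : secondDiffCheck g y0 = true) {t : ℝ} (ht : t ≠ 0)
    (ρ : ℝ) :
    BPoly.eval (secondDiffQuot g y0) t ρ =
      (2 * Poly.eval g ((y0 : ℝ) + ρ) - Poly.eval g ((y0 : ℝ) + ρ - t) - Poly.eval g ((y0 : ℝ) + ρ + t)) / t := by
  rw [← eval_secondDiffQuot hc t ρ, mul_div_cancel_left₀ _ ht]

/-! ## The divided first difference `H` -/

/-- Numerator `g(y₀+ρ) − g(y₀+ρ−t)` as a `BPoly`. [folklore] -/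
def firstDiffNum (g : Poly) (y0 : ℚ) : BPoly := BPoly.add (shiftZero g y0) (BPoly.neg (shiftMinus g y0))

/-- [folklore] -/
theorem eval_firstDiffNum (g : Poly) (y0 : ℚ) (t ρ : ℝ) :
    BPoly.eval (firstDiffNum g y0) t ρ = Poly.eval g ((y0 : ℝ) + ρ) - Poly.eval g ((y0 : ℝ) + ρ - t) := by
  rw [firstDiffNum, BPoly.eval_add, BPoly.eval_neg, eval_shiftZero, eval_shiftMinus]
  ring

/-- Kernel check for `H`. [folklore] -/
def firstDiffCheck (g : Poly) (y0 : ℚ) : Bool := BPoly.headsZero (firstDiffNum g y0)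

/-- **The divided first difference** `H(ρ,t) = (g(y₀+ρ) − g(y₀+ρ−t))/t` as a `BPoly`. [folklore] -/
def firstDiffQuot (g : Poly) (y0 : ℚ) : BPoly := BPoly.mapInner List.tail (firstDiffNum g y0)

/-- Soundness: `t · H(ρ,t) = g(y₀+ρ) − g(y₀+ρ−t)` (given the check). [folklore] -/
theorem eval_firstDiffQuot {g : Poly} {y0 : ℚ} (hc : firstDiffCheck g y0 = true) (t ρ : ℝ) :
    t * BPoly.eval (firstDiffQuot g y0) t ρ = Poly.eval g ((y0 : ℝ) + ρ) - Poly.eval g ((y0 : ℝ) + ρ - t) := by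
  rw [firstDiffQuot, BPoly.mul_eval_tails_of_headsZero hc, eval_firstDiffNum]

/-- The divided form: for `t ≠ 0`, `H(ρ,t) = (g(y₀+ρ) − g(y₀+ρ−t))/t`. [folklore] -/
theorem eval_firstDiffQuot_eq_div {g : Poly} {y0 : ℚ} (hc : firstDiffCheck g y0 = true) {t : ℝ} (ht : t ≠ 0)
    (ρ : ℝ) :
    BPoly.eval (firstDiffQuot g y0) t ρ = (Poly.eval g ((y0 : ℝ) + ρ) - Poly.eval g ((y0 : ℝ) + ρ - t)) / t := by
  rw [← eval_firstDiffQuot hc t ρ, mul_div_cancel_left₀ _ ht]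

/-! ## A worked instance (kernel): `g(x) = x³ − 2x`, `y₀ = 1/3` -/

/-- The checks hold for a sample cubic (`decide +kernel`). [folklore] -/
example : secondDiffCheck [0, -2, 0, 1] (1 / 3) = true ∧ firstDiffCheck [0, -2, 0, 1] (1 / 3) = true := by
  constructor <;> decide +kernel

end Literature.Analysis.ValidatedNumerics.ExpPoly
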